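import Literature.NumberTheory.LFunctions.WeilCombFamilyWeights
import Literature.NumberTheory.LFunctions.WeilCombBumpPeriodization
import Mathlib.Analysis.SpecialFunctions.Integrals.Basic

/-!
# Crux `SignCone.ConeMagnification` (stmt-RiemannHypothesis-16303), line `Sketch` r9, stub `stub_combType` — sharp node evaluation III:
# the family integrals sum to the periodization integral

Backstop, part 3 (continues `…CombTypeFamilyApprox`).  After `Literature.NumberTheory.LFunctions.abs_familySum_sub_integral_le` each
family `m ≠ 0` of a node contributes `(1/P) ∫_0^{K₁} B(-m K₀/s)/s ds` (`K₀ = g/(nℓ'h)`); summed over `0 < |m| ≤ M₀` and substituting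
`v = s/K₀` this is the integral of `(A(v) − B(0))/v` over `(0, V]`, `V = K₁/K₀`, `A(v) = Σ_{m ∈ ℤ} B(m/v)` the periodization of
`Literature/NumberTheory/LFunctions/WeilCombBumpPeriodization.lean`; since `A = B(0)` on `(0, 1/2]` and
`(A(v) − B(0))/v = H(v) + ∫B − B(0)/v` (`H(v) = (A(v) − v∫B)/v`) on `[1/2, V]`:

  `Σ_{0<|m|≤M₀} ∫_0^{K₁} B(−mK₀/s)/s ds = I_H − ∫_V^∞ H + (∫B)(V − 1/2) − B(0) log(2V)`,  `I_H = ∫_{1/2}^∞ H`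

(`CombType.sum_family_integrals_eq`), valid for `K₀ > 0`, `V ≥ 1/2`, `2V < M₀ + 1`.
-/

noncomputable section

-- `Summit.RiemannHypothesis.RiemannHypothesis.…` repeats a namespace component by design (D-0017 layout).
set_option linter.dupNamespace false

open scoped BigOperators
open MeasureTheory Set intervalIntegral

namespace Summit.RiemannHypothesis.RiemannHypothesis.Theorems.SignConeConeMagnification

open Literature.NumberTheory.LFunctions

namespace CombType

/-- The family weight `s ↦ B(c/s)/s` is continuous (`c ≠ 0`). [folklore] -/
theorem continuous_familyWeight {B B' : ℝ → ℝ} (hB : ∀ x, HasDerivAt B (B' x) x) (hBs : ∀ x, 2 < |x| → B x = 0)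
    {c : ℝ} (hc : c ≠ 0) : Continuous fun s => B (c / s) / s :=
  continuous_iff_continuousAt.2 fun s => (hasDerivAt_familyWeight hB hBs hc s).continuousAt

/-- The finite family sum `v ↦ Σ_{0<|m|≤M₀} B(−m/v)/v` is continuous. [folklore] -/
theorem continuous_familySum {B B' : ℝ → ℝ} (hB : ∀ x, HasDerivAt B (B' x) x) (hBs : ∀ x, 2 < |x| → B x = 0)
    (M₀ : ℕ) : Continuous fun v : ℝ => ∑ m ∈ (Finset.Icc (-(M₀ : ℤ)) M₀).erase 0, B (-(m : ℝ) / v) / v := by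
  refine continuous_finsetSum _ fun m hm => ?_
  have hm0 : (m : ℝ) ≠ 0 := by exact_mod_cast (Finset.mem_erase.1 hm).1
  exact continuous_familyWeight hB hBs (neg_ne_zero.2 hm0)

/-- On `(0, 1/2]` every family `m ≠ 0` vanishes: `B(−m/v) = 0` (`|m/v| ≥ 2`). [folklore] -/
theorem familySum_eq_zero_of_le_half {B : ℝ → ℝ} (hBc : Continuous B) (hBs : ∀ x, 2 < |x| → B x = 0)
    (M₀ : ℕ) {v : ℝ} (hv : 0 ≤ v) (hv2 : v ≤ 1 / 2) :
    ∑ m ∈ (Finset.Icc (-(M₀ : ℤ)) M₀).erase 0, B (-(m : ℝ) / v) / v = 0 := by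
  rcases hv.lt_or_eq with hv0 | hv0
  · refine Finset.sum_eq_zero fun m hm => ?_
    have hm0 : m ≠ 0 := (Finset.mem_erase.1 hm).1
    have hm1 : (1 : ℝ) ≤ |(m : ℝ)| := by
      have : 1 ≤ |m| := Int.one_le_abs hm0
      exact_mod_cast this
    rw [eq_zero_of_two_le_abs hBc hBs ?_, zero_div]
    rw [abs_div, abs_neg, abs_of_pos hv0, le_div_iff₀ hv0]
    nlinarith
  · subst hv0; simp

/-- On `(0, ∞)` with `2v < M₀ + 1` the finite family sum is the periodization minus `B(0)`:
`Σ_{0<|m|≤M₀} B(−m/v) = A(v) − B(0)`. [folklore] -/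
theorem familySum_eq_periodization_sub {B : ℝ → ℝ} (hBs : ∀ x, 2 < |x| → B x = 0) {M₀ : ℕ} {v : ℝ} (hv : 0 < v)
    (hvM : 2 * v < M₀ + 1) :
    ∑ m ∈ (Finset.Icc (-(M₀ : ℤ)) M₀).erase 0, B (-(m : ℝ) / v) = (∑' m : ℤ, B (m / v)) - B 0 := by
  rw [periodization_eq_sum hBs hv hvM]
  have h0 : (0 : ℤ) ∈ Finset.Icc (-(M₀ : ℤ)) M₀ := by simp
  -- reindex `m ↦ -m` on the symmetric interval
  have hre : ∑ m ∈ Finset.Icc (-(M₀ : ℤ)) M₀, B (-(m : ℝ) / v) = ∑ m ∈ Finset.Icc (-(M₀ : ℤ)) M₀, B ((m : ℝ) / v) := by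
    refine Finset.sum_nbij' (fun m => -m) (fun m => -m) ?_ ?_ ?_ ?_ ?_
    · intro m hm; simp only [Finset.mem_Icc] at hm ⊢; omega
    · intro m hm; simp only [Finset.mem_Icc] at hm ⊢; omega
    · intro m _; ring
    · intro m _; ring
    · intro m _; push_cast; ring_nf
  rw [Finset.sum_erase_eq_sub h0, hre]
  simp

/-- **The family integrals sum to the periodization integral.**  See the module docstring. [folklore] -/
theorem sum_family_integrals_eq {B B' B'' : ℝ → ℝ} {N₂ : ℝ}
    (hB : ∀ x, HasDerivAt B (B' x) x) (hB' : ∀ x, HasDerivAt B' (B'' x) x)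
    (h2 : ∀ x, |B'' x| ≤ N₂) (hBs : ∀ x, 2 < |x| → B x = 0)
    {K₀ K₁ : ℝ} (hK₀ : 0 < K₀) {M₀ : ℕ} (hV : 1 / 2 ≤ K₁ / K₀) (hVM : 2 * (K₁ / K₀) < M₀ + 1) :
    ∑ m ∈ (Finset.Icc (-(M₀ : ℤ)) M₀).erase 0, ∫ s in (0 : ℝ)..K₁, B (-(m : ℝ) * K₀ / s) / s
      = (∫ v in Ioi (1 / 2 : ℝ), ((∑' m : ℤ, B (m / v)) - v * ∫ x, B x) / v)
        - (∫ v in Ioi (K₁ / K₀), ((∑' m : ℤ, B (m / v)) - v * ∫ x, B x) / v)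
        + (∫ x, B x) * (K₁ / K₀ - 1 / 2) - B 0 * Real.log (2 * (K₁ / K₀)) := by
  have hBc : Continuous B := continuous_iff_continuousAt.2 fun x => (hB x).continuousAt
  set V : ℝ := K₁ / K₀ with hVdef
  have hV0 : 0 < V := by linarith
  have hK₁ : K₁ = K₀ * V := by rw [hVdef]; field_simp
  set f : ℝ → ℝ := fun v => ∑ m ∈ (Finset.Icc (-(M₀ : ℤ)) M₀).erase 0, B (-(m : ℝ) / v) / v with hf
  have hfc : Continuous f := continuous_familySum hB hBs M₀
  -- (1) sum of integrals = integral of the sum, and the substitution `s = K₀ v`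
  have hstep1 : ∑ m ∈ (Finset.Icc (-(M₀ : ℤ)) M₀).erase 0, ∫ s in (0 : ℝ)..K₁, B (-(m : ℝ) * K₀ / s) / s
      = ∫ s in (0 : ℝ)..K₁, K₀⁻¹ * f (s / K₀) := by
    rw [← intervalIntegral.integral_finsetSum]
    · refine intervalIntegral.integral_congr fun s _ => ?_
      simp only [hf, Finset.mul_sum]
      refine Finset.sum_congr rfl fun m _ => ?_
      rcases eq_or_ne s 0 with hs | hs
      · simp [hs]
      · field_simp
    · intro m hm
      have hm0 : (m : ℝ) ≠ 0 := by exact_mod_cast (Finset.mem_erase.1 hm).1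
      have hc : -(m : ℝ) * K₀ ≠ 0 := mul_ne_zero (neg_ne_zero.2 hm0) hK₀.ne'
      exact ((continuous_familyWeight hB hBs hc).intervalIntegrable _ _)
  have hstep2 : ∫ s in (0 : ℝ)..K₁, K₀⁻¹ * f (s / K₀) = ∫ v in (0 : ℝ)..V, f v := by
    rw [intervalIntegral.integral_const_mul, intervalIntegral.integral_comp_div _ hK₀.ne', zero_div, ← hVdef,
      smul_eq_mul, ← mul_assoc, inv_mul_cancel₀ hK₀.ne', one_mul]
  -- (2) split at `1/2`; the piece over `[0, 1/2]` vanishes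
  have hsplit : ∫ v in (0 : ℝ)..V, f v = (∫ v in (0 : ℝ)..(1 / 2), f v) + ∫ v in (1 / 2 : ℝ)..V, f v :=
    (intervalIntegral.integral_add_adjacent_intervals (hfc.intervalIntegrable _ _) (hfc.intervalIntegrable _ _)).symm
  have hzero : ∫ v in (0 : ℝ)..(1 / 2), f v = 0 := by
    rw [intervalIntegral.integral_congr (g := fun _ => (0 : ℝ)) fun v hv => ?_, intervalIntegral.integral_zero]
    rw [uIcc_of_le (by norm_num : (0 : ℝ) ≤ 1 / 2)] at hv
    exact familySum_eq_zero_of_le_half hBc hBs M₀ hv.1 hv.2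
  -- (3) on `[1/2, V]`: `f = H + ∫B − B(0)/v`
  set H : ℝ → ℝ := fun v => ((∑' m : ℤ, B (m / v)) - v * ∫ x, B x) / v with hH
  have hfH : ∀ v ∈ uIcc (1 / 2 : ℝ) V, f v = H v + ((∫ x, B x) - B 0 / v) := by
    intro v hv
    rw [uIcc_of_le hV] at hv
    have hv0 : 0 < v := by linarith [hv.1]
    have hvM : 2 * v < M₀ + 1 := by linarith [hv.2]
    simp only [hf, hH]
    rw [← Finset.sum_div, familySum_eq_periodization_sub hBs hv0 hvM]
    field_simp
    ring
  have hHint : IntervalIntegrable H volume (1 / 2) V := by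
    rw [intervalIntegrable_iff_integrableOn_Ioc_of_le hV]
    exact (integrableOn_periodizationH hB hB' h2 hBs (le_refl (1 / 2 : ℝ))).mono_set Ioc_subset_Ioi_self
  have hGint : IntervalIntegrable (fun v : ℝ => (∫ x, B x) - B 0 / v) volume (1 / 2) V := by
    refine (continuousOn_const.sub (continuousOn_const.div continuousOn_id fun v hv => ?_)).intervalIntegrable
    rw [uIcc_of_le hV] at hv
    exact (by linarith [hv.1] : (0 : ℝ) < v).ne'
  have hstep3 : ∫ v in (1 / 2 : ℝ)..V, f v = (∫ v in (1 / 2 : ℝ)..V, H v) + ∫ v in (1 / 2 : ℝ)..V, ((∫ x, B x) - B 0 / v) := by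
    rw [intervalIntegral.integral_congr hfH, intervalIntegral.integral_add hHint hGint]
  -- (4) the elementary integral
  have hstep4 : ∫ v in (1 / 2 : ℝ)..V, ((∫ x, B x) - B 0 / v) = (∫ x, B x) * (V - 1 / 2) - B 0 * Real.log (2 * V) := by
    rw [intervalIntegral.integral_sub intervalIntegrable_const, intervalIntegral.integral_const, smul_eq_mul]
    · have : ∫ v in (1 / 2 : ℝ)..V, B 0 / v = B 0 * Real.log (2 * V) := by
        have e : (fun v : ℝ => B 0 / v) = fun v => B 0 * v⁻¹ := by funext v; rw [div_eq_mul_inv]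
        rw [e, intervalIntegral.integral_const_mul, integral_inv_of_pos (by norm_num) hV0]
        rw [show V / (1 / 2) = 2 * V by ring]
      rw [this]; ring
    · refine (continuousOn_const.div continuousOn_id fun v hv => ?_).intervalIntegrable
      rw [uIcc_of_le hV] at hv
      exact (by linarith [hv.1] : (0 : ℝ) < v).ne'
  -- (5) the `H`-integral over `[1/2, V]`
  have hstep5 : ∫ v in (1 / 2 : ℝ)..V, H v = (∫ v in Ioi (1 / 2 : ℝ), H v) - ∫ v in Ioi V, H v := by
    have := integral_periodizationH_Ioi_eq_add hB hB' h2 hBs hV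
    simp only [hH] at this ⊢
    linarith
  rw [hstep1, hstep2, hsplit, hzero, zero_add, hstep3, hstep4, hstep5]
  ring

/-- **Anchor `combTypePeriodIntegral`** (registered sub-goal; `sum_family_integrals_eq` with explicit quantifiers): the family
integrals sum to the periodization integral. [folklore] -/
theorem combTypePeriodIntegral : ∀ B B' B'' : ℝ → ℝ, ∀ N₂ : ℝ, (∀ x, HasDerivAt B (B' x) x) → (∀ x, HasDerivAt B' (B'' x) x) → (∀ x, |B'' x| ≤ N₂) → (∀ x, 2 < |x| → B x = 0) → ∀ K₀ K₁ : ℝ, (0 < K₀) → ∀ M₀ : ℕ, (1 / 2 ≤ K₁ / K₀) → (2 * (K₁ / K₀) < M₀ + 1) → ∑ m ∈ (Finset.Icc (-(M₀ : ℤ)) M₀).erase 0, ∫ s in (0 : ℝ)..K₁, B (-(m : ℝ) * K₀ / s) / s = (∫ v in Set.Ioi (1 / 2 : ℝ), ((∑' m : ℤ, B (m / v)) - v * ∫ x, B x) / v) - (∫ v in Set.Ioi (K₁ / K₀), ((∑' m : ℤ, B (m / v)) - v * ∫ x, B x) / v) + (∫ x, B x) * (K₁ / K₀ - 1 / 2)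 - B 0 * Real.log (2 * (K₁ / K₀)) :=
  fun _ _ _ _ hB hB' h2 hBs _ _ hK₀ _ hV hVM => sum_family_integrals_eq hB hB' h2 hBs hK₀ hV hVM

end CombType

end Summit.RiemannHypothesis.RiemannHypothesis.Theorems.SignConeConeMagnification

end
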